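import Summits.MatrixMultiplication.MatrixMultiplication.Theorems.FarEdgeDescentIsolatedTower
import HarnessLib

/-!
# Far-edge descent, kernel XXXV-C: Schönhage's asymmetric pairs `⟨1,(e−1)(l−1),1⟩ ⊕ ⟨e,1,l⟩` with an ISOLATED anchor

Route `FarEdgeDescent`, special leaf `FiniteSaturation` (stmt-MatrixMultiplication-23739): helper kernel,
THESES-FREE and def-free (decomp-mm lens 2 «structural dichotomy», gen 55; answers lens 1's ASK-L2-49 (i)).

Kernel XXXII-D (`FarEdgeDescentIsolatedTower.base_isolated`) realised only the symmetric member `E₃ =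
⟨1,4,1⟩ ⊕ ⟨3,1,3⟩` (length `10`) of Schönhage's family.  Here the WHOLE two-parameter family is realised
with an isolated anchor, over every field:

* §1 `outerRect_entry`, `outerRect_improvable` — the rectangular outer product `⟨e,1,l⟩` (`xᵢ yₖ`,
  `i < e`, `k < l`) by `e·l + 1` products IMPROVABLY: the `el` trivial triads `e_{ik} ⊗ xᵢ ⊗ yₖ` plus the
  wasted triad `0 ⊗ (∑ᵢ xᵢ) ⊗ (∑ₖ yₖ)` with weights `dₛ = 1` (`s ≤ el`) and `−1` (the wasted one) — an
  exact (order-`0`) realization whose weighted inner products `∑ₛ dₛ uₛ(b) vₛ(c) = 1 − 1` vanish for ALL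
  inputs `b, c` (Schönhage 1981, §5; Knuth TAOCP 2, §4.6.4 Ex. 67(g)).
* §2 `base_isolated_pair` — for `e, l ≥ 1`, `⟨1,(e−1)(l−1),1⟩ ⊕ ⟨e,1,l⟩` has an approximate realization of
  length `e·l + 1` whose weighted inner products vanish off the anchor inputs (kernel XXXII-A
  `isolated_reanchor`; budget `(e−1)(l−1) + e + l = el + 1` is EXACT — the anchor is free), i.e. the
  `IsolatedInvariant` shape consumed by the isolated step / tower kernels (XXXII-B/C) and by lens 1's thin
  tower chain (`SaturationLadderTowerChain`); `base_isolated_two_five` — the member `(e,l) = (2,5)`: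
  `⟨1,4,1⟩ ⊕ ⟨2,1,5⟩` by `11` products (the family's `sup` of the thin weight `t = log((e−1)(l−1))/(el·log e)`
  is `1/5`, attained here: lens 1 NODE g49 §2(e), census v37), and `base_isolated_square` — the diagonal
  `⟨1,(n−1)²,1⟩ ⊕ ⟨n,1,n⟩` by `n² + 1` (`n = 3` is `E₃`; `n = 4`: `⟨1,9,1⟩ ⊕ ⟨4,1,4⟩` by `17`, Schönhage's
  `ω < 2.548`; Pan 1984 §16).

What it is for.  (a) Lens 1 (ASK-L2-49 (i)): an asymmetric isolated tower over `(2,5)` or general `(e,l)`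
can now be built from `isolated_stage` exactly as the `E₃` tower, to decide whether the squaring-tower
method is capped near its rung `0` in the thin currency at every aspect `r = log l/log e` (lens 1 expects
yes).  (b) Lens 2: the moment readout of kernel XXXV-A/B is base-agnostic (`moment_invariant` needs only
`G₀ ≥ L₀·exp(((s−1)M₀ − (1−t)N₀)/L₀)`); for a symmetric-slot tower the base enters through `(r₀, Q₀, L₀,
M₀)` alone, and the structural exponent `θ_S = log(4/3)/log(3/2)` of the squaring clock does not see the
base at all (XXXV-A `stage_envelope`) — so new bases change constants and the FAT/THIN intercept, never
the far-edge exponent; recorded here so that no seat spends a generation on "a better base for the rate".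

References: Schönhage 1981, §5 (partial matrix multiplication, the pairs `⟨e,1,l⟩ ⊕ ⟨1,(e−1)(l−1),1⟩`);
Knuth TAOCP 2, §4.6.4 Ex. 67(g); Pan 1984 (LNCS 179) §16; Coppersmith–Winograd 1982, §3;
Bürgisser–Clausen–Shokrollahi 1997, §15.5 (Ex. 15.21).
Tags: `FiniteSaturation` (h₁) NEC · WEAKER · ATTACKED (unchanged; infrastructure for asymmetric towers).
-/

set_option linter.dupNamespace false

noncomputable section

open scoped BigOperators Polynomial
open Polynomial

namespace Summit.MatrixMultiplication.MatrixMultiplication.Theorems.FarEdgeDescentSchonhagePairBase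

open Literature.Computability.AlgebraicComplexity
open Summit.MatrixMultiplication.MatrixMultiplication.Theorems.FarEdgeDescentIsolatedStep

variable (K : Type) [Field K]

/-! ## §1 The rectangular outer product `⟨e,1,l⟩` by `el + 1` products, improvably -/

/-- The entries of the one-block direct sum `⟨e,1,l⟩` (an outer product `xᵢyₖ`). [folklore] -/
theorem outerRect_entry (e l : ℕ) (a : Σ _ : Fin 1, Fin e × Fin l) (b : Σ _ : Fin 1, Fin e × Fin 1)
    (c : Σ _ : Fin 1, Fin 1 × Fin l) :
    matMulDirectSum K (fun _ : Fin 1 => e) (fun _ => 1) (fun _ => l) a b c =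
      if a.2.1 = b.2.1 ∧ a.2.2 = c.2.2 then 1 else 0 := by
  obtain ⟨ia, i, k⟩ := a
  obtain ⟨ib, i', z⟩ := b
  obtain ⟨ic, z', k'⟩ := c
  obtain rfl : ia = ib := Subsingleton.elim _ _
  obtain rfl : ia = ic := Subsingleton.elim _ _
  obtain rfl : z = z' := Subsingleton.elim _ _
  simp [matMulDirectSum, Fin.ext_iff]

/-- **`⟨e,1,l⟩` by `el + 1` products, improvably** (Schönhage 1981, §5; Knuth TAOCP 2, §4.6.4
Ex. 67(g)): the `el` trivial triads `e_{ik} ⊗ xᵢ ⊗ yₖ` plus the wasted triad `0 ⊗ (∑ᵢxᵢ) ⊗ (∑ₖyₖ)`,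
with weights `dₛ = 1` (`s ≤ el`) and `−1` (the wasted one): an exact (order-`0`) realization whose
weighted inner products `∑ₛ dₛ uₛ(b) vₛ(c) = 1 − 1` vanish for ALL inputs `b, c`.
[cite: Schonhage1981, §5] [cite: KnuthTAOCP2, §4.6.4, Ex. 67(g)] -/
theorem outerRect_improvable (e l : ℕ) :
    ∃ (w : Fin (e * l + 1) → (Σ _ : Fin 1, Fin e × Fin l) → K[X])
      (u : Fin (e * l + 1) → (Σ _ : Fin 1, Fin e × Fin 1) → K[X])
      (v : Fin (e * l + 1) → (Σ _ : Fin 1, Fin 1 × Fin l) → K[X]) (d : Fin (e * l + 1) → K[X]),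
      IsApproxDecomposition 0 (matMulDirectSum K (fun _ : Fin 1 => e) (fun _ => 1) (fun _ => l))
        w u v ∧ (∀ s, d s ≠ 0) ∧ ∀ b c, ∑ s, d s * u s b * v s c = 0 := by
  classical
  have hcard : Fintype.card (Fin e × Fin l ⊕ Unit) = e * l + 1 := by simp
  let ι : Fin (e * l + 1) ≃ (Fin e × Fin l ⊕ Unit) := (Fintype.equivFinOfCardEq hcard).symm
  -- scalar factors and weights on the index set `Fin e × Fin l ⊕ Unit`
  let W : (Fin e × Fin l ⊕ Unit) → (Σ _ : Fin 1, Fin e × Fin l) → K :=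
    fun x a => Sum.elim (fun ik => if a.2 = ik then (1 : K) else 0) (fun _ => 0) x
  let U : (Fin e × Fin l ⊕ Unit) → (Σ _ : Fin 1, Fin e × Fin 1) → K :=
    fun x b => Sum.elim (fun ik => if ik.1 = b.2.1 then (1 : K) else 0) (fun _ => 1) x
  let V : (Fin e × Fin l ⊕ Unit) → (Σ _ : Fin 1, Fin 1 × Fin l) → K :=
    fun x c => Sum.elim (fun ik => if ik.2 = c.2.2 then (1 : K) else 0) (fun _ => 1) x
  let D : (Fin e × Fin l ⊕ Unit) → K := fun x => Sum.elim (fun _ => (1 : K)) (fun _ => -1) x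
  refine ⟨fun s a => C (W (ι s) a), fun s b => C (U (ι s) b), fun s c => C (V (ι s) c),
    fun s => C (D (ι s)), ?_, ?_, ?_⟩
  · intro a b c j hj
    obtain rfl : j = 0 := Nat.le_zero.1 hj
    simp only [← Polynomial.C_mul, if_true, Polynomial.finsetSum_coeff, Polynomial.coeff_C_zero]
    rw [show (∑ s, W (ι s) a * U (ι s) b * V (ι s) c) = ∑ x, W x a * U x b * V x c from
      Equiv.sum_comp ι (fun x => W x a * U x b * V x c), Fintype.sum_sum_type, outerRect_entry]
    simp only [W, U, V, Sum.elim_inl, Sum.elim_inr, zero_mul, Finset.sum_const_zero, add_zero]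
    rw [Finset.sum_eq_single a.2 (fun ik _ hik => by rw [if_neg (Ne.symm hik), zero_mul, zero_mul])
      (fun h => absurd (Finset.mem_univ _) h), if_pos rfl, one_mul]
    by_cases h1 : a.2.1 = b.2.1 <;> by_cases h2 : a.2.2 = c.2.2 <;> simp [h1, h2]
  · intro s
    rw [Ne, Polynomial.C_eq_zero]
    simp only [D]
    cases ι s <;> simp
  · intro b c
    simp only [← Polynomial.C_mul]
    rw [← map_sum, Polynomial.C_eq_zero,
      show (∑ s, D (ι s) * U (ι s) b * V (ι s) c) = ∑ x, D x * U x b * V x c from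
        Equiv.sum_comp ι (fun x => D x * U x b * V x c), Fintype.sum_sum_type]
    simp only [D, U, V, Sum.elim_inl, Sum.elim_inr, one_mul, mul_one, Finset.univ_unique,
      Finset.sum_singleton]
    rw [Finset.sum_eq_single (b.2.1, c.2.2) (fun ik _ hik => ?_)
      (fun h => absurd (Finset.mem_univ _) h)]
    · simp
    · obtain ⟨x, y⟩ := ik
      by_cases hx : x = b.2.1
      · subst hx
        have hy : y ≠ c.2.2 := fun hy => hik (by rw [hy])
        simp [hy]
      · simp [hx]

/-! ## §2 The isolated-anchor realizations -/

/-- **Schönhage's pair with an isolated anchor** (ASK-L2-49 (i)): for `e, l ≥ 1`,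
`⟨1,(e−1)(l−1),1⟩ ⊕ ⟨e,1,l⟩` has an approximate realization of length `el + 1` whose weighted inner
products vanish off the anchor inputs (kernel XXXII-A `isolated_reanchor` applied to
`outerRect_improvable e l`; the budget `(e−1)(l−1) + e·1 + 1·l ≤ el + 1` holds with EQUALITY).
[cite: Schonhage1981, §5] [cite: CoppersmithWinograd1982, §3] [cite: KnuthTAOCP2, §4.6.4, Ex. 67(g)] -/
theorem base_isolated_pair {e l : ℕ} (he : 1 ≤ e) (hl : 1 ≤ l) :
    ∃ (H : ℕ) (u : Fin (e * l + 1) → _ → K[X]) (v : Fin (e * l + 1) → _ → K[X])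
      (w : Fin (e * l + 1) → _ → K[X]) (d : Fin (e * l + 1) → K[X]),
      IsApproxDecomposition H (matMulDirectSum K (Fin.cons 1 (fun _ : Fin 1 => e))
        (Fin.cons ((e - 1) * (l - 1)) (fun _ : Fin 1 => 1)) (Fin.cons 1 (fun _ : Fin 1 => l))) u v w ∧
      (∀ s, d s ≠ 0) ∧ ∀ b c, ¬ (b.1 = 0 ∧ c.1 = 0) → ∑ s, d s * v s b * w s c = 0 := by
  obtain ⟨w, u, v, d, hreal, hd, himp⟩ := outerRect_improvable K e l
  refine isolated_reanchor (fun _ : Fin 1 => e) (fun _ : Fin 1 => 1) (fun _ : Fin 1 => l) hreal d hd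
    himp (q := (e - 1) * (l - 1)) ?_
  obtain ⟨e, rfl⟩ := Nat.exists_eq_add_of_le' he
  obtain ⟨l, rfl⟩ := Nat.exists_eq_add_of_le' hl
  simp only [Nat.add_sub_cancel, Finset.univ_unique, Finset.sum_singleton, mul_one, one_mul]
  exact le_of_eq (by ring)

/-- The member `(e,l) = (2,5)` of the family: **`⟨1,4,1⟩ ⊕ ⟨2,1,5⟩` by `11` products** with an
isolated anchor (the family's thin weight `t = log((e−1)(l−1))/(el log e)` attains its `sup = 1/5`
here; Schönhage 1981, §5).
[cite: Schonhage1981, §5] [cite: KnuthTAOCP2, §4.6.4, Ex. 67(g)] -/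
theorem base_isolated_two_five :
    ∃ (H : ℕ) (u : Fin (2 * 5 + 1) → _ → K[X]) (v : Fin (2 * 5 + 1) → _ → K[X])
      (w : Fin (2 * 5 + 1) → _ → K[X]) (d : Fin (2 * 5 + 1) → K[X]),
      IsApproxDecomposition H (matMulDirectSum K (Fin.cons 1 (fun _ : Fin 1 => 2))
        (Fin.cons 4 (fun _ : Fin 1 => 1)) (Fin.cons 1 (fun _ : Fin 1 => 5))) u v w ∧
      (∀ s, d s ≠ 0) ∧ ∀ b c, ¬ (b.1 = 0 ∧ c.1 = 0) → ∑ s, d s * v s b * w s c = 0 :=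
  base_isolated_pair K (e := 2) (l := 5) (by norm_num) (by norm_num)

/-- The diagonal `(e,l) = (n,n)`, `n ≥ 1`: **`⟨1,(n−1)²,1⟩ ⊕ ⟨n,1,n⟩` by `n² + 1` products** with an
isolated anchor (`n = 3` is `E₃`, kernel XXXII-D `base_isolated`; `n = 4` is `⟨1,9,1⟩ ⊕ ⟨4,1,4⟩` by `17`,
Schönhage's `ω < 2.548`).
[cite: Schonhage1981, §5] [cite: Pan1984, §16] [cite: KnuthTAOCP2, §4.6.4, Ex. 67(g)] -/
theorem base_isolated_square {n : ℕ} (hn : 1 ≤ n) :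
    ∃ (H : ℕ) (u : Fin (n * n + 1) → _ → K[X]) (v : Fin (n * n + 1) → _ → K[X])
      (w : Fin (n * n + 1) → _ → K[X]) (d : Fin (n * n + 1) → K[X]),
      IsApproxDecomposition H (matMulDirectSum K (Fin.cons 1 (fun _ : Fin 1 => n))
        (Fin.cons ((n - 1) * (n - 1)) (fun _ : Fin 1 => 1)) (Fin.cons 1 (fun _ : Fin 1 => n))) u v w ∧
      (∀ s, d s ≠ 0) ∧ ∀ b c, ¬ (b.1 = 0 ∧ c.1 = 0) → ∑ s, d s * v s b * w s c = 0 :=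
  base_isolated_pair K hn hn

end Summit.MatrixMultiplication.MatrixMultiplication.Theorems.FarEdgeDescentSchonhagePairBase

end
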